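import Summits.ResolutionOfSingularities.ResolutionOfSingularities.Theorems.EquisingularLiftEquisingularLiftNatDirectionCentreChartRing
import Summits.ResolutionOfSingularities.ResolutionOfSingularities.Theorems.EquisingularLiftEquisingularLiftNatBlowupStalkPrescribedChart
import Summits.ResolutionOfSingularities.ResolutionOfSingularities.Theorems.EquisingularLiftEquisingularLiftNatBlowupChartPointInjective
import Summits.ResolutionOfSingularities.ResolutionOfSingularities.Theorems.EquisingularLiftEquisingularLiftNatDirectionCentreComap
import Literature.AlgebraicGeometry.Resolution.CoefficientIdealRestriction
import HarnessLib

/-!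
# [OURS · L1 W4.5(b) · EL♮(3)] DIRDICT (a) part 1 — THE FRAME ADAPTED TO A SECTION CURVE: at a point `y ∈ Γ` of a section of the
# exceptional `ℙ¹`-bundle over `z`, a quasi-regular frame `(ℓ, m)` of `Ī_z` with `y` on the chart `m` and `ℓ/m ∈ 𝓘_{Γ,y}`

Crux chain w45b (cell `res-hironaka`, slot W4.5(b)), working crux **EL♮** = stmt-ResolutionOfSingularities-20038, child **EL♮(3)** =
stmt-ResolutionOfSingularities-20148, route EquisingularLift, line `sections`; registered stubs `stub_elnat_ratDirZeroPointResolution`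
(rung DIR₀₀) and `stub_elnat_ratTowerPointResolution` (TOWER₀, Čech-witnessed rounds); object **DIRDICT (a)** «section curve of the
exceptional ruled surface ↦ direction along the carrier» (res-L1-w45b-plan-1 RULING-6 17:51:04Z / WORD (α) 17:58:13Z / NO OBJECTION
18:12:58Z: currency (α) CHARTWISE ROOTED = res-L1-w45b-stub-2's T-DIRLIFT ideal currency D1–D4; spec `L/res-D-pv-051/TARGET-DIRDICT.sig.md`,
typed sig `TARGET-DIRDICT-a.sig.lean`). HONEST FRAMING: OURS; NOT a statement of any manuscript; AI-written, weaker than expert review.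
No `sorry`; standard axioms. DEF-FREE. `--supports stmt-ResolutionOfSingularities-20148 --as helper`.

SETTING (root-local, downstairs). `υ : G₁ → G` a blowing up along `Ī = 𝓘⟨Z⟩` (the reduced carrier curve `Z̃ = V(Ī)`), `E = υ⁻¹Z` the
exceptional ruled surface, `Γ ⊆ E` closed, `Γ̃ = V(𝓘⟨Γ⟩)` the reduced structure; «`Γ` is a SECTION» = `DirStepSec` read at the root:
an isomorphism `δ : Γ̃ ⟶ Z̃` over `υ`.

WHAT (namespace `…Cruxes.EquisingularLiftNat.Sections`).
* §1 `IsQuasiRegular.of_linearSubst` — quasi-regularity (Matsumura §16) is kept by an invertible homogeneous-linear change of the frame;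
  `isQuasiRegular_pair_swap'` (`(ℓ, m) ↦ (m, ℓ)`), `isQuasiRegular_pair_sub_mul` (`(ℓ, m) ↦ (ℓ − α m, m)`), and the spans.
* §2 ring level: `exists_sub_map_mem_of_surjective` — if `R → S/P` (through `φ : R → S`) is onto, every `s ∈ S` (e.g. the fraction
  `χ(c_j/c_i)` of a chart presentation) is `≡ φ α (mod P)` for some `α ∈ R`; `apply_frac_pair_sub_mul` — in the adapted frame
  `(c_0 − α c_1, c_1)` ANY chart-`c_1` presentation `χ'` has `χ'((c_0 − α c_1)/c_1) = χ(c_0/c_1) − φ α` (`φ c_1` a non-zero-divisor).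
* §3 stalk level: `surjective_and_ker_mk_comp_stalkMap_of_section` — for closed subschemes `V(IΓ) ⊆ G₁`, `V(IZ) ⊆ G` and an
  ISOMORPHISM `V(IΓ) ≅ V(IZ)` over `υ` (a section), at `y ∈ V(IΓ)` over `z`: `𝒪_{G,z} → 𝒪_{G₁,y}/(IΓ)_y` is ONTO with kernel `(IZ)_z`;
  **`exists_sectionAdaptedFrame_of_generator` / `exists_sectionAdaptedFrame`** — for every quasi-regular frame of `(IZ)_z` (`υ` a blowing up along
  `IZ`, `𝒪_{G,z} → 𝒪_{G₁,y}/P` onto) there is an ADAPTED one: a quasi-regular frame `c = (ℓ, m)` of `(IZ)_z` together with a chart-`m`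
  presentation `(𝔔, χ)` of `𝒪_{G₁,y}` (`χ` over `υ♯_y`, `𝒪_{G₁,y} = R[(IZ)_z/m]_𝔔`, `𝔔 ∩ R = 𝔪_z`, `(IZ·𝒪_{G₁})_y = (υ♯ m)`) such that
  `χ(ℓ/m) ∈ P` — for `P = 𝓘_{Γ,y}`: the section is `{ℓ/m = 0}` on the chart `m` near `y`.
Part 2 (…NatDirDictCriterion) proves `controlledTransform υ Ī 𝒟 1 = 𝓘⟨Γ⟩` for a direction adapted in this sense; part 3
(…NatDirDictSection) constructs the direction `𝒟 = Ī ⊓ υ_*(𝓘⟨Γ⟩·𝓔)`.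

References: H. Matsumura, *Commutative Ring Theory* (1986), §16 (quasi-regular sequences); The Stacks Project, Tags 0804, 052P — through
the tree (Literature `QuasiRegularSequences`, `BlowupAlgebraPresentation`; T-PTPRIME p521370/p540294 `exists_chartPresentation_of_eq`,
`stalkIdeal_comap_eq_span_of_chartPresentation`; T-PRES-CHART p537631 `exists_blowupAlgebra_stalk_ringEquiv_of_stalkIdeal_eq_span`;
D1 p547943 `mem_nonZeroDivisors_of_stalkIdeal_comap_eq_span`; Literature `ker_stalkMap_subschemeι`).
-/

noncomputable section

open CategoryTheory AlgebraicGeometry TopologicalSpace IsLocalRing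
open Literature.AlgebraicGeometry.Resolution
open AlgebraicGeometry.Scheme.IdealSheafData

set_option linter.dupNamespace false -- mandated namespace `Summit.<Summit>.<Problem>` of this single-conjunct summit

namespace Summit.ResolutionOfSingularities.ResolutionOfSingularities.Cruxes.EquisingularLiftNat.Sections

universe u

/-! ## 1. Quasi-regularity under an invertible linear change of the frame -/

section Algebra

variable {R : Type u} [CommRing R]

open MvPolynomial in
/-- **Quasi-regularity is invariant under an invertible homogeneous-linear substitution.** If `x` is quasi-regular, `f` is a family of
linear forms with a left inverse substitution `g` (`g ∘ f = X`), `y_i = f_i(x)` and `(y) = (x)`, then `y` is quasi-regular: a form `F`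
with `F(y) ∈ (x)^{n+1}` gives the form `F ∘ f` with `(F ∘ f)(x) = F(y)`, so `F ∘ f ∈ (x)·R[X]`, and `F = (F ∘ f) ∘ g ∈ (x)·R[X]`.
[cite: Matsumura1987, §16 Definition p. 124] -/
theorem IsQuasiRegular.of_linearSubst {ι : Type*} {x y : ι → R} (f g : ι → MvPolynomial ι R)
    (hf : ∀ i, (f i).IsHomogeneous 1) (hgf : ∀ i, bind₁ g (f i) = X i)
    (hfx : ∀ i, eval x (f i) = y i) (hspan : Ideal.span (Set.range y) = Ideal.span (Set.range x))
    (hx : IsQuasiRegular x) : IsQuasiRegular y := by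
  intro n F hF hFy
  have h1 : (bind₁ f F).IsHomogeneous n := by
    simpa [aeval_eq_bind₁] using hF.aeval f hf
  have h2 : eval x (bind₁ f F) = eval y F := by
    change eval₂Hom (RingHom.id R) x (bind₁ f F) = _
    rw [eval₂Hom_bind₁]
    change eval (fun i => eval x (f i)) F = _
    simp_rw [hfx]
  have h3 : bind₁ f F ∈ Ideal.map (C : R →+* MvPolynomial ι R) (Ideal.span (Set.range x)) :=
    hx n (bind₁ f F) h1 (by rw [h2, ← hspan]; exact hFy)
  have h4 : bind₁ g (bind₁ f F) = F := by
    rw [bind₁_bind₁]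
    have hfun : (fun i => bind₁ g (f i)) = X := funext hgf
    rw [hfun, bind₁_X_left, AlgHom.id_apply]
  have hC : ((bind₁ g : MvPolynomial ι R →ₐ[R] MvPolynomial ι R) : MvPolynomial ι R →+* MvPolynomial ι R).comp C = C :=
    RingHom.ext fun r => by simp
  rw [hspan, ← h4]
  have h5 := Ideal.mem_map_of_mem ((bind₁ g : MvPolynomial ι R →ₐ[R] MvPolynomial ι R) : MvPolynomial ι R →+* MvPolynomial ι R) h3
  rw [Ideal.map_map, hC] at h5
  exact h5

/-- The span of a pair indexed by `Fin 2`. [folklore] -/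
theorem span_range_fin_two (c : Fin 2 → R) : Ideal.span (Set.range c) = Ideal.span {c 0, c 1} := by
  congr 1
  ext a
  simp only [Set.mem_range, Fin.exists_fin_two, Set.mem_insert_iff, Set.mem_singleton_iff, eq_comm]

/-- Swapping a pair does not change its span. [folklore] -/
theorem span_range_pair_swap (c : Fin 2 → R) : Ideal.span (Set.range ![c 1, c 0]) = Ideal.span (Set.range c) := by
  rw [span_range_fin_two, span_range_fin_two c]
  simp only [Matrix.cons_val_zero, Matrix.cons_val_one]
  rw [Set.pair_comm]

/-- The elementary change `(ℓ, m) ↦ (ℓ − α m, m)` does not change the span. [folklore] -/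
theorem span_range_pair_sub_mul (c : Fin 2 → R) (α : R) :
    Ideal.span (Set.range ![c 0 - α * c 1, c 1]) = Ideal.span (Set.range c) := by
  rw [span_range_fin_two, span_range_fin_two c]
  simp only [Matrix.cons_val_zero, Matrix.cons_val_one]
  apply le_antisymm
  · rw [Ideal.span_le]
    rintro a (rfl | rfl)
    · exact Ideal.sub_mem _ (Ideal.subset_span (by simp)) (Ideal.mul_mem_left _ _ (Ideal.subset_span (by simp)))
    · exact Ideal.subset_span (by simp)
  · rw [Ideal.span_le]
    rintro a (rfl | rfl)
    · have h : c 0 = (c 0 - α * c 1) + α * c 1 := by ring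
      rw [SetLike.mem_coe, h]
      exact Ideal.add_mem _ (Ideal.subset_span (by simp)) (Ideal.mul_mem_left _ _ (Ideal.subset_span (by simp)))
    · exact Ideal.subset_span (by simp)

open MvPolynomial in
/-- **Swapping a quasi-regular pair keeps it quasi-regular.** [cite: Matsumura1987, §16 Definition p. 124] -/
theorem isQuasiRegular_pair_swap' {c : Fin 2 → R} (hc : IsQuasiRegular c) : IsQuasiRegular ![c 1, c 0] := by
  refine IsQuasiRegular.of_linearSubst (x := c) ![X 1, X 0] ![X 1, X 0] ?_ ?_ ?_ (span_range_pair_swap c) hc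
  · intro i; fin_cases i <;> simpa using isHomogeneous_X R _
  · intro i; fin_cases i <;> simp [bind₁_X_right]
  · intro i; fin_cases i <;> simp

open MvPolynomial in
/-- **The elementary change `(ℓ, m) ↦ (ℓ − α m, m)` keeps a quasi-regular pair quasi-regular.** [cite: Matsumura1987, §16 Definition p. 124] -/
theorem isQuasiRegular_pair_sub_mul {c : Fin 2 → R} (hc : IsQuasiRegular c) (α : R) :
    IsQuasiRegular ![c 0 - α * c 1, c 1] := by
  refine IsQuasiRegular.of_linearSubst (x := c) ![X 0 - C α * X 1, X 1] ![X 0 + C α * X 1, X 1] ?_ ?_ ?_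
    (span_range_pair_sub_mul c α) hc
  · intro i
    fin_cases i
    · simpa using (isHomogeneous_X R (0 : Fin 2)).sub ((isHomogeneous_X R (1 : Fin 2)).C_mul α)
    · simpa using isHomogeneous_X R _
  · intro i
    fin_cases i
    · simp [bind₁_X_right, map_sub, map_mul]
    · simp [bind₁_X_right]
  · intro i; fin_cases i <;> simp

end Algebra

/-! ## 2. Ring level: the adapted constant and the fraction in the adapted frame -/

section Ring

variable {R S : Type u} [CommRing R] [CommRing S] (φ : R →+* S) (P : Ideal S)

/-- If `R → S ⧸ P` (through `φ`) is onto, every element of `S` is `≡ φ α (mod P)`; in particular the fraction `χ(c_j/c_i)` of a chart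
presentation. [folklore] -/
theorem exists_sub_map_mem_of_surjective (hsurj : Function.Surjective ((Ideal.Quotient.mk P).comp φ)) (s : S) :
    ∃ α : R, s - φ α ∈ P := by
  obtain ⟨α, hα⟩ := hsurj (Ideal.Quotient.mk P s)
  exact ⟨α, Ideal.Quotient.eq.mp ((RingHom.comp_apply _ _ _).symm.trans hα).symm⟩

/-- **The fraction in the adapted frame.** For a frame `c = (c_0, c_1)` of `I ⊆ R`, `φ : R → S` with `φ c_1` a non-zero-divisor, an element
`u ∈ S` with `u · φ c_1 = φ c_0` (the fraction `c_0/c_1` of some chart-`c_1` presentation) and ANY ring map `χ'` from the chart algebra of the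
adapted frame `(c_0 − α c_1, c_1)` on the chart `c_1` extending `φ`: `χ'((c_0 − α c_1)/c_1) = u − φ α`. [cite: StacksProject, Tag 052P] -/
theorem apply_frac_pair_sub_mul (c : Fin 2 → R) (α : R) {u : S} (hmul : u * φ (c 1) = φ (c 0))
    (hnzd : φ (c 1) ∈ nonZeroDivisors S)
    (χ' : blowupAlgebra (Ideal.span (Set.range ![c 0 - α * c 1, c 1])) (![c 0 - α * c 1, c 1] 1) →+* S)
    (hχ' : ∀ a, χ' (algebraMap _ _ a) = φ a) :
    χ' (blowupAlgebra.frac ![c 0 - α * c 1, c 1] 1 0) = u - φ α := by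
  have h := apply_frac_mul ![c 0 - α * c 1, c 1] 1 0 χ' φ hχ'
  change χ' (blowupAlgebra.frac ![c 0 - α * c 1, c 1] 1 0) * φ (c 1) = φ (c 0 - α * c 1) at h
  rw [map_sub, map_mul] at h
  have h' : χ' (blowupAlgebra.frac ![c 0 - α * c 1, c 1] 1 0) * φ (c 1) = (u - φ α) * φ (c 1) := by
    rw [h, sub_mul, hmul]
  exact (mul_cancel_right_mem_nonZeroDivisors hnzd).mp h'

end Ring

/-! ## 3. Stalk level: the section and the adapted frame -/

section Stalk

variable {G₁ G : Scheme.{u}} {υ : G₁ ⟶ G}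

/-- Transport of stalk-ideal membership along `𝒪_{X,x} ≅ 𝒪_{X,x'}` for equal points. [folklore] -/
theorem stalkCongr_hom_mem_stalkIdeal_iff {X : Scheme.{u}} (I : X.IdealSheafData) {x x' : X} (h : x = x')
    (r : X.presheaf.stalk x) :
    (X.presheaf.stalkCongr (.of_eq h)).hom r ∈ stalkIdeal I x' ↔ r ∈ stalkIdeal I x := by
  subst h
  rw [TopCat.Presheaf.stalkCongr_hom, stalkSpecializes_self_apply]

/-- **A section gives `𝒪_{G,z} ↠ 𝒪_{G₁,y} ⧸ 𝓘_{Γ,y}` with kernel `Ī_z`.** Let `IΓ` (on `G₁`) and `IZ` (on `G`) be ideal sheaves and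
`δ : V(IΓ) ⟶ V(IZ)` an ISOMORPHISM over `υ : G₁ → G` (`δ ≫ ι_Z = ι_Γ ≫ υ`; for the reduced structures on a section curve and the carrier
curve this is `DirStepSec` read at the root). Then for every point `y'` of `V(IΓ)`, `y = ι_Γ y'`: the composite
`𝒪_{G,υ y} → 𝒪_{G₁,y} → 𝒪_{G₁,y} ⧸ (IΓ)_y` is surjective and its kernel is `(IZ)_{υ y}`. [folklore] -/
theorem surjective_and_ker_mk_comp_stalkMap_of_section {IΓ : G₁.IdealSheafData} {IZ : G.IdealSheafData}
    (δ : IΓ.subscheme ⟶ IZ.subscheme) [IsIso δ] (hδ : δ ≫ IZ.subschemeι = IΓ.subschemeι ≫ υ) (y' : ↥IΓ.subscheme) :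
    Function.Surjective ((Ideal.Quotient.mk (stalkIdeal IΓ (IΓ.subschemeι y'))).comp (υ.stalkMap (IΓ.subschemeι y')).hom) ∧
    RingHom.ker ((Ideal.Quotient.mk (stalkIdeal IΓ (IΓ.subschemeι y'))).comp (υ.stalkMap (IΓ.subschemeι y')).hom) =
      stalkIdeal IZ (υ (IΓ.subschemeι y')) := by
  -- the quotient map by `(IΓ)_y` is, up to isomorphism, `ι_Γ♯ : 𝒪_{G₁,y} → 𝒪_{V(IΓ),y'}`
  set q := (IΓ.subschemeι.stalkMap y').hom with hq
  have hqker : RingHom.ker q = stalkIdeal IΓ (IΓ.subschemeι y') := ker_stalkMap_subschemeι IΓ y'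
  set φ := (υ.stalkMap (IΓ.subschemeι y')).hom with hφ
  -- `q ∘ φ = (ι_Γ ≫ υ)♯ = (stalkCongr) ≫ (δ ≫ ι_Z)♯ = stalkCongr ≫ ι_Z♯ ≫ δ♯`
  have hA : q.comp φ = ((IΓ.subschemeι ≫ υ).stalkMap y').hom := by
    rw [Scheme.Hom.stalkMap_comp]; rfl
  have hpt : (IΓ.subschemeι ≫ υ) y' = (δ ≫ IZ.subschemeι) y' := by rw [hδ]
  have hB : (IΓ.subschemeι ≫ υ).stalkMap y' =
      (G.presheaf.stalkCongr (.of_eq hpt)).hom ≫ (δ ≫ IZ.subschemeι).stalkMap y' :=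
    Scheme.Hom.stalkMap_congr_hom _ _ hδ.symm y'
  have hC : ((δ ≫ IZ.subschemeι).stalkMap y').hom = (δ.stalkMap y').hom.comp (IZ.subschemeι.stalkMap (δ y')).hom := by
    rw [Scheme.Hom.stalkMap_comp]; rfl
  have hδbij : Function.Bijective (δ.stalkMap y').hom := ConcreteCategory.bijective_of_isIso (δ.stalkMap y')
  have hcbij : Function.Bijective (G.presheaf.stalkCongr (.of_eq hpt)).hom.hom :=
    ConcreteCategory.bijective_of_isIso (G.presheaf.stalkCongr (.of_eq hpt)).hom
  have hιZsurj : Function.Surjective (IZ.subschemeι.stalkMap (δ y')).hom := IZ.subschemeι.stalkMap_surjective (δ y')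
  have hιZker : RingHom.ker (IZ.subschemeι.stalkMap (δ y')).hom = stalkIdeal IZ (IZ.subschemeι (δ y')) :=
    ker_stalkMap_subschemeι IZ (δ y')
  have hθ : q.comp φ = ((δ.stalkMap y').hom.comp (IZ.subschemeι.stalkMap (δ y')).hom).comp
      (G.presheaf.stalkCongr (.of_eq hpt)).hom.hom := by
    rw [hA, hB, CommRingCat.hom_comp, hC]
    rfl
  -- surjectivity of `q ∘ φ`
  have hθsurj : Function.Surjective (q.comp φ) := by
    rw [hθ]
    exact (hδbij.2.comp hιZsurj).comp hcbij.2
  -- kernel of `q ∘ φ`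
  have hθker : RingHom.ker (q.comp φ) = stalkIdeal IZ (υ (IΓ.subschemeι y')) := by
    rw [hθ]
    ext r
    rw [RingHom.mem_ker]
    change (δ.stalkMap y').hom ((IZ.subschemeι.stalkMap (δ y')).hom ((G.presheaf.stalkCongr (.of_eq hpt)).hom.hom r)) = 0 ↔ _
    rw [map_eq_zero_iff _ hδbij.1, ← RingHom.mem_ker, hιZker]
    exact stalkCongr_hom_mem_stalkIdeal_iff IZ hpt r
  refine ⟨fun s => ?_, ?_⟩
  · obtain ⟨s₀, rfl⟩ := Ideal.Quotient.mk_surjective s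
    obtain ⟨r, hr⟩ := hθsurj (q s₀)
    refine ⟨r, ?_⟩
    rw [RingHom.comp_apply, Ideal.Quotient.eq, ← hqker, RingHom.mem_ker, map_sub, sub_eq_zero]
    exact hr
  · rw [← hθker]
    ext r
    simp only [RingHom.mem_ker, RingHom.comp_apply, Ideal.Quotient.eq_zero_iff_mem, ← hqker]

/-- **The adapted frame, core case: the chart generator is prescribed.** `υ : G₁ → G` a blowing up along `IZ`, `y ∈ G₁` a point at
which `𝒪_{G,υ y} → 𝒪_{G₁,y} ⧸ P` is onto (`P` an ideal of `𝒪_{G₁,y}`; for `P = 𝓘_{Γ,y}` this is the section property), `c = (c_0, c_1)`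
a quasi-regular frame of `(IZ)_{υ y}` whose member `c_1` generates the exceptional stalk at `y`. Then for some `α`, the frame
`c' = (c_0 − α c_1, c_1)` is again a quasi-regular frame of `(IZ)_{υ y}`, `y` is presented on its chart `c'_1 = c_1` (`𝔔`, `χ`, localisation,
`𝔔 ∩ R = 𝔪`), and `χ((c_0 − α c_1)/c_1) ∈ P`. [cite: StacksProject, Tag 0804] -/
theorem exists_sectionAdaptedFrame_of_generator {IZ : G.IdealSheafData} (hυ : IsBlowup υ IZ) (y : G₁)
    (P : Ideal (G₁.presheaf.stalk y))
    (hsurj : Function.Surjective ((Ideal.Quotient.mk P).comp (υ.stalkMap y).hom))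
    (c : Fin 2 → G.presheaf.stalk (υ y)) (hc : Ideal.span (Set.range c) = stalkIdeal IZ (υ y)) (hqr : IsQuasiRegular c)
    (hgen : stalkIdeal (IZ.comap υ) y = Ideal.span {(υ.stalkMap y).hom (c 1)}) :
    ∃ (c' : Fin 2 → G.presheaf.stalk (υ y))
      (𝔔 : PrimeSpectrum (blowupAlgebra (Ideal.span (Set.range c')) (c' 1)))
      (χ : blowupAlgebra (Ideal.span (Set.range c')) (c' 1) →+* G₁.presheaf.stalk y),
      Ideal.span (Set.range c') = stalkIdeal IZ (υ y) ∧ IsQuasiRegular c' ∧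
      (∀ a, χ (algebraMap _ _ a) = (υ.stalkMap y).hom a) ∧
      @IsLocalization.AtPrime _ _ (G₁.presheaf.stalk y) _ χ.toAlgebra 𝔔.asIdeal _ ∧
      𝔔.asIdeal.comap (algebraMap _ (blowupAlgebra (Ideal.span (Set.range c')) (c' 1))) =
        maximalIdeal (G.presheaf.stalk (υ y)) ∧
      stalkIdeal (IZ.comap υ) y = Ideal.span {(υ.stalkMap y).hom (c' 1)} ∧
      χ (blowupAlgebra.frac c' 1 0) ∈ P := by
  -- a chart-`c 1` presentation of `y` for the OLD frame (T-PRES-CHART)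
  obtain ⟨𝔔₀, χ₀, -, hχ₀, -, -, -⟩ := exists_blowupAlgebra_stalk_ringEquiv_of_stalkIdeal_eq_span hυ y c hc 1 hgen
  -- the adapted constant `α`: `χ₀(c_0/c_1) ≡ υ♯ α (mod P)`
  obtain ⟨α, hα⟩ := exists_sub_map_mem_of_surjective (υ.stalkMap y).hom P hsurj (χ₀ (blowupAlgebra.frac c 1 0))
  -- the adapted frame `c' = (c_0 − α c_1, c_1)`
  have hc' : Ideal.span (Set.range ![c 0 - α * c 1, c 1]) = stalkIdeal IZ (υ y) := by rw [span_range_pair_sub_mul, hc]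
  have hqr' : IsQuasiRegular ![c 0 - α * c 1, c 1] := isQuasiRegular_pair_sub_mul hqr α
  have hgen' : stalkIdeal (IZ.comap υ) y = Ideal.span {(υ.stalkMap y).hom (![c 0 - α * c 1, c 1] 1)} := hgen
  -- the presentation on the prescribed chart `c' 1 = c 1` for the NEW frame
  obtain ⟨𝔔, χ, -, hχ, hloc, -, h𝔔⟩ :=
    exists_blowupAlgebra_stalk_ringEquiv_of_stalkIdeal_eq_span hυ y ![c 0 - α * c 1, c 1] hc' 1 hgen'
  refine ⟨![c 0 - α * c 1, c 1], 𝔔, χ, hc', hqr', hχ, hloc, h𝔔, hgen', ?_⟩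
  -- `χ((c_0 − α c_1)/c_1) = χ₀(c_0/c_1) − υ♯ α ∈ P`
  have hnzd : (υ.stalkMap y).hom (c 1) ∈ nonZeroDivisors _ :=
    mem_nonZeroDivisors_of_stalkIdeal_comap_eq_span hυ y hgen
  have hmul : χ₀ (blowupAlgebra.frac c 1 0) * (υ.stalkMap y).hom (c 1) = (υ.stalkMap y).hom (c 0) :=
    apply_frac_mul c 1 0 χ₀ (υ.stalkMap y).hom hχ₀
  rw [apply_frac_pair_sub_mul (υ.stalkMap y).hom c α hmul hnzd χ hχ]
  exact hα

/-- **The adapted frame from ANY quasi-regular frame.** Same, starting from an arbitrary quasi-regular frame `c` of `(IZ)_{υ y}`: present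
`y` on some chart `c_i` (`exists_chartPresentation_of_eq`); if `i = 0` swap the pair first; then `exists_sectionAdaptedFrame_of_generator`.
[cite: StacksProject, Tag 0804] -/
theorem exists_sectionAdaptedFrame {IZ : G.IdealSheafData} (hυ : IsBlowup υ IZ) (y : G₁)
    (P : Ideal (G₁.presheaf.stalk y))
    (hsurj : Function.Surjective ((Ideal.Quotient.mk P).comp (υ.stalkMap y).hom))
    (c : Fin 2 → G.presheaf.stalk (υ y)) (hc : Ideal.span (Set.range c) = stalkIdeal IZ (υ y)) (hqr : IsQuasiRegular c) :
    ∃ (c' : Fin 2 → G.presheaf.stalk (υ y))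
      (𝔔 : PrimeSpectrum (blowupAlgebra (Ideal.span (Set.range c')) (c' 1)))
      (χ : blowupAlgebra (Ideal.span (Set.range c')) (c' 1) →+* G₁.presheaf.stalk y),
      Ideal.span (Set.range c') = stalkIdeal IZ (υ y) ∧ IsQuasiRegular c' ∧
      (∀ a, χ (algebraMap _ _ a) = (υ.stalkMap y).hom a) ∧
      @IsLocalization.AtPrime _ _ (G₁.presheaf.stalk y) _ χ.toAlgebra 𝔔.asIdeal _ ∧
      𝔔.asIdeal.comap (algebraMap _ (blowupAlgebra (Ideal.span (Set.range c')) (c' 1))) =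
        maximalIdeal (G.presheaf.stalk (υ y)) ∧
      stalkIdeal (IZ.comap υ) y = Ideal.span {(υ.stalkMap y).hom (c' 1)} ∧
      χ (blowupAlgebra.frac c' 1 0) ∈ P := by
  obtain ⟨i, 𝔔₀, χ₀, hχ₀, -, -⟩ := exists_chartPresentation_of_eq hυ y rfl c hc
  have hgen₀ := stalkIdeal_comap_eq_span_of_chartPresentation (π := υ) (J := IZ) y rfl c hc i χ₀ hχ₀
  rw [stalkCongr_refl_inv_stalkMap_apply] at hgen₀
  fin_cases i
  · -- chart `c 0`: swap the pair
    have hcs : Ideal.span (Set.range ![c 1, c 0]) = stalkIdeal IZ (υ y) := by rw [span_range_pair_swap, hc]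
    exact exists_sectionAdaptedFrame_of_generator hυ y P hsurj ![c 1, c 0] hcs (isQuasiRegular_pair_swap' hqr) hgen₀
  · exact exists_sectionAdaptedFrame_of_generator hυ y P hsurj c hc hqr hgen₀

end Stalk

end Summit.ResolutionOfSingularities.ResolutionOfSingularities.Cruxes.EquisingularLiftNat.Sections

end
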